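import Summits.QuantumFields.YangMills.Theorems.FlatTubeReductionFibreFactorReferenceMass
import Summits.QuantumFields.YangMills.Theorems.FlatTubeReductionRecordProfileReweightedNumbers
import Summits.QuantumFields.YangMills.Theorems.FlatTubeReductionOutputWeightDomination
import HarnessLib

/-!
# The fibre factors OF RECORD are reference masses of the reweighted record profile

Support file for the crux `NearFlatRatioLaw` (line `ratepack_v2`, stub `stub_hODpot_A`, terminal fibre-side statement of record,
`Cruxes/NearFlatRatioLaw/Lines/ratepack-v7-moments-g18.md` §14).

`…FibreFactorReferenceMass.fibre_factor_le_reference_mass` instantiated with the data of record: `Ω = recordProfile L β` (the literal record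
profile of `…CoreDefectRecordOrbitMoments`), `Ω₁` = the capped inner weight of `…OutputWeightDomination` at radius `R_in ≤ r_f`, fibre core
`C = coreBox L β`, reweighting exponent `K = 4`, Faddeev–Popov radius `ε = β^{-1}`, and the profile-number constant `A` of
`…RecordProfileReweightedNumbers.recordProfile_reweighted_moment_le_core`: `record_fibre_factor_le_reference_mass` — for all large `β` and all
`a, k, j ≤ 4`, `∫dπ Ω₁(v̂)‖v̂‖^{2a}·∫dc T[recordProfile·‖·‖^{2k}, coreWeight β^{-1} R₁·G^j](c⁻¹ oT(1,v) c; 1) ≤ β^{-(a+k+j)}·Ξ·fpBOKernel β (recordProfile·(1+β‖·‖²)^4) (fpWeight β^{-1}) 1 1`.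
-/

noncomputable section

open MeasureTheory Filter Topology Real Set
open scoped BigOperators
open Literature.MathematicalPhysics.QuantumFieldTheory
open Literature.MathematicalPhysics.QuantumLattice

namespace Summit.QuantumFields.YangMills.Theorems.FemtoTransferGap.RateTube

open Summit.QuantumFields.YangMills.Theorems.FemtoTransferGap
open Summit.QuantumFields.YangMills.Theorems.FemtoTransferGap.TwoLattice
open Summit.QuantumFields.YangMills.Theorems.FemtoTransferGap.TwoLattice.ConstTube
open Summit.QuantumFields.YangMills.Theorems.FemtoTransferGap.TwoLattice.Avg
open Summit.QuantumFields.YangMills.Theorems.FemtoTransferGap.TwoLattice.Stiff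
open Summit.QuantumFields.YangMills.Theorems.FemtoTransferGap.TwoLattice.GnChart

variable (L : ℕ) [NeZero L]

/-- ★★★ **THE FIBRE FACTORS OF RECORD ARE REFERENCE MASSES** (see the module docstring). [cite: Luscher1983, §3] -/
theorem record_fibre_factor_le_reference_mass (hL : 2 ≤ L) :
    ∃ Ξ β₄ : ℝ, 0 ≤ Ξ ∧ ∀ β : ℝ, β₄ ≤ β → ∀ {Rin : ℝ}, Rin ≤ min (1 / 40) (powScale (1 / 2) β * btLog β) → ∀ (R₁ : ℝ) {a k j : ℕ}, a ≤ 4 → k ≤ 4 → j ≤ 4 →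
      ∫ v, ({x : LinkSpace L | linkCurry x ∈ capBalancedSet L}.indicator (fun _ => (1 : ℝ)) (linkEmbed L v) *
            ({x : LinkSpace L | ‖x‖ ≤ Rin}.indicator (fun _ => (1 : ℝ)) (linkEmbed L v) *
              (Real.exp (-(stiffGaussExp L (β / 2) β (linkEmbed L v))) * Real.exp (-(‖(gaugeModes L).starProjection (linkEmbed L v)‖ ^ 2 / powScale 1 β ^ 2))))) *
          (‖linkEmbed L v‖ ^ 2) ^ a *
          ∫ c, fpFibreTransfer L β (fun x => recordProfile L β x * (‖x‖ ^ 2) ^ k) (fun g => coreWeight L (powScale 1 β) R₁ g * (∑ x, ‖su2Quat (g x) - 1‖ ^ 2) ^ j)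
            (gaugeTransform (fun _ : Site 3 L => c⁻¹) (orthoTube L 1 v)) 1 ∂haarProbability SU2 ∂orthoTransverse L ≤
        (β ^ (a + k + j))⁻¹ * Ξ * fpBOKernel L β (fun x => recordProfile L β x * (1 + β * ‖x‖ ^ 2) ^ 4) (fpWeight L (powScale 1 β)) 1 1 := by
  haveI := isFiniteMeasure_orthoTransverse L
  have hle := measurable_linkEmbed L
  obtain ⟨hΩm, hΩ01, hΩabs, -⟩ := recordProfile_fields L
  -- the profile numbers of the reweighted record profile
  obtain ⟨A, β₃, hA0, hβ₃1, hnum⟩ := recordProfile_reweighted_moment_le_core L hL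
  obtain ⟨k₀, β₂, hk₀, hβ₂, hfloor⟩ := recordProfile_core_floor L
  set n : ℕ := Fintype.card {x : Site 3 L // ¬x = 0} with hn
  have hAA : 0 ≤ A 8 + A (8 + 3 * n) := add_nonneg (hA0 _) (hA0 _)
  obtain ⟨Ξ₁, hΞ₁, hFF⟩ := fibre_factor_le_reference_mass (L := L) hAA
  refine ⟨Ξ₁, max (max β₃ β₂) 900, hΞ₁, fun β hβ Rin hRin R₁ a k j ha hk hj => ?_⟩
  have hβ900 : 900 ≤ β := (le_max_right _ _).trans hβ
  have hβ3 : β₃ ≤ β := ((le_max_left _ _).trans (le_max_left _ _)).trans hβ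
  have hβ2 : β₂ ≤ β := ((le_max_right _ _).trans (le_max_left _ _)).trans hβ
  have hβ1 : 1 ≤ β := by linarith
  have hβ0 : 0 ≤ β := by linarith
  -- the record profile's data
  have hΩt : ∀ v : Edge 3 L → Fin 3 → ℝ, recordProfile L β (linkEmbed L v) ≠ 0 → v ∈ capBalancedSet L ∧ ‖linkEmbed L v‖ ≤ min (1 / 40) (powScale (1 / 2) β * btLog β) :=
    fun v hv => ⟨(recordProfile_support L hv).1, (recordProfile_support L hv).2.2⟩
  have hR1 : min (1 / 40) (powScale (1 / 2) β * btLog β) ≤ 1 := (min_le_left _ _).trans (by norm_num)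
  -- the output weight
  have hq : ∀ (g : SU2) (x : LinkSpace L), (fun β' : ℝ => stiffGaussExp L (β' / 2) β') β (adL L g x) = (fun β' : ℝ => stiffGaussExp L (β' / 2) β') β x :=
    fun g x => stiffGaussExp_adL (β / 2) β g x
  have hΩ₁m := measurable_capInnerWeight (L := L) (q := fun β' : ℝ => stiffGaussExp L (β' / 2) β') (β := β) (measurable_stiffGaussExp (β / 2) β) Rin
  have hΩ₁inv := capInnerWeight_adL (L := L) (q := fun β' : ℝ => stiffGaussExp L (β' / 2) β') (β := β) hq Rin
  have hΩ₁le := capInnerWeight_le_capRestrict (L := L) (fun β' : ℝ => stiffGaussExp L (β' / 2) β') (fun β' => min (1 / 40) (powScale (1 / 2) β' * btLog β')) β hRin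
  have hΩ₁0 : ∀ x : LinkSpace L, 0 ≤ {x : LinkSpace L | linkCurry x ∈ capBalancedSet L}.indicator (fun _ => (1 : ℝ)) x *
      ({x : LinkSpace L | ‖x‖ ≤ Rin}.indicator (fun _ => (1 : ℝ)) x * (Real.exp (-((fun β' : ℝ => stiffGaussExp L (β' / 2) β') β x)) *
        Real.exp (-(‖(gaugeModes L).starProjection x‖ ^ 2 / powScale 1 β ^ 2)))) := fun x =>
    mul_nonneg (Set.indicator_nonneg (fun _ _ => zero_le_one) _) (mul_nonneg (Set.indicator_nonneg (fun _ _ => zero_le_one) _)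
      (mul_nonneg (Real.exp_nonneg _) (Real.exp_nonneg _)))
  -- the Faddeev–Popov radius
  have hε : 0 < powScale 1 β := powScale_pos _ _
  have hβε : β * powScale 1 β ^ 2 ≤ 1 := by
    rw [sq, ← mul_assoc, mul_powScale_one hβ1, one_mul]; exact powScale_le_one zero_le_one β
  -- the core: `coreBox` is the `hCsub` set by definition
  have hCsub : ∀ v ∈ coreBox L β, v ∈ capBalancedSet L ∧ ‖linkEmbed L v‖ ≤ (Real.sqrt β)⁻¹ ∧ ∀ (e : Edge 3 L) (c : Fin 3), |v e c| ≤ (Real.sqrt β)⁻¹ :=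
    fun v hv => hv
  -- the numbers
  obtain ⟨h80, hcore⟩ := hnum β hβ3 8 0 4
  obtain ⟨h83, -⟩ := hnum β hβ3 8 (3 * n) 4
  have hvol : 0 < (volume {w : {e : Edge 3 L // ¬e.1 = 0} → Fin 3 → ℝ | balLevel L β (balExt L w) ≤ 1}).toReal :=
    ENNReal.toReal_pos (volume_sublevel_one_pos L β).ne' (volume_sublevel_one_lt_top L hβ1).ne
  have hθ0 : 0 < ∫ v in coreBox L β, recordProfile L β (linkEmbed L v) ∂orthoTransverse L := lt_of_lt_of_le (mul_pos hk₀ hvol) (hfloor β hβ2)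
  have hθ : 0 < ∫ v in coreBox L β, recordProfile L β (linkEmbed L v) * (1 + β * ‖linkEmbed L v‖ ^ 2) ^ 4 ∂orthoTransverse L := lt_of_lt_of_le hθ0 hcore
  have e8 : ∀ v : Edge 3 L → Fin 3 → ℝ, recordProfile L β (linkEmbed L v) * (1 + β * ‖linkEmbed L v‖ ^ 2) ^ 4 * (1 + β * ‖linkEmbed L v‖ ^ 2) ^ 4 =
      recordProfile L β (linkEmbed L v) * (1 + β * ‖linkEmbed L v‖ ^ 2) ^ 8 * (Real.sqrt β * ‖linkEmbed L v‖) ^ 0 := fun v => by ring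
  have e83 : ∀ v : Edge 3 L → Fin 3 → ℝ, recordProfile L β (linkEmbed L v) * (1 + β * ‖linkEmbed L v‖ ^ 2) ^ 4 * (1 + β * ‖linkEmbed L v‖ ^ 2) ^ 4 *
      (Real.sqrt β * ‖linkEmbed L v‖) ^ (3 * n) =
      recordProfile L β (linkEmbed L v) * (1 + β * ‖linkEmbed L v‖ ^ 2) ^ 8 * (Real.sqrt β * ‖linkEmbed L v‖) ^ (3 * n) := fun v => by ring
  have hn1 : ∫ v, recordProfile L β (linkEmbed L v) * (1 + β * ‖linkEmbed L v‖ ^ 2) ^ 4 * (1 + β * ‖linkEmbed L v‖ ^ 2) ^ 4 ∂orthoTransverse L ≤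
      (A 8 + A (8 + 3 * n)) * ∫ v in coreBox L β, recordProfile L β (linkEmbed L v) * (1 + β * ‖linkEmbed L v‖ ^ 2) ^ 4 ∂orthoTransverse L := by
    rw [integral_congr_ae (ae_of_all _ e8)]
    calc _ ≤ A (8 + 0) * ∫ v in coreBox L β, recordProfile L β (linkEmbed L v) ∂orthoTransverse L := h80
      _ ≤ (A 8 + A (8 + 3 * n)) * ∫ v in coreBox L β, recordProfile L β (linkEmbed L v) * (1 + β * ‖linkEmbed L v‖ ^ 2) ^ 4 ∂orthoTransverse L :=
          mul_le_mul (by rw [add_zero]; linarith [hA0 (8 + 3 * n)]) hcore hθ0.le hAA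
  have hn2 : ∫ v, recordProfile L β (linkEmbed L v) * (1 + β * ‖linkEmbed L v‖ ^ 2) ^ 4 * (1 + β * ‖linkEmbed L v‖ ^ 2) ^ 4 *
      (Real.sqrt β * ‖linkEmbed L v‖) ^ (3 * Fintype.card {x : Site 3 L // ¬x = 0}) ∂orthoTransverse L ≤
      (A 8 + A (8 + 3 * n)) * ∫ v in coreBox L β, recordProfile L β (linkEmbed L v) * (1 + β * ‖linkEmbed L v‖ ^ 2) ^ 4 ∂orthoTransverse L := by
    rw [← hn, integral_congr_ae (ae_of_all _ e83)]
    calc _ ≤ A (8 + 3 * n) * ∫ v in coreBox L β, recordProfile L β (linkEmbed L v) ∂orthoTransverse L := h83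
      _ ≤ (A 8 + A (8 + 3 * n)) * ∫ v in coreBox L β, recordProfile L β (linkEmbed L v) * (1 + β * ‖linkEmbed L v‖ ^ 2) ^ 4 ∂orthoTransverse L :=
          mul_le_mul (by linarith [hA0 8]) hcore hθ0.le hAA
  -- assemble
  have h := hFF hβ900 (hΩm β) hΩ₁m (hΩabs β) (fun x => (hΩ01 β x).1) hΩ₁0 hΩ₁le hΩ₁inv hR1 hΩt hε hβε (K := 4) (measurableSet_coreBox L β) hCsub hθ hn1 hn2 R₁ ha hk hj
  exact h

end Summit.QuantumFields.YangMills.Theorems.FemtoTransferGap.RateTube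

end
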